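import Summits.MatrixMultiplication.MatrixMultiplication.Theorems.SoloInformedOneOneOneDirectSum
import Summits.MatrixMultiplication.MatrixMultiplication.Theorems.SoloInformedCatalystNoGo
import HarnessLib

/-!
# A finite catalyst certificate for `T_cw,2` forces a 111-abundant, non-111-sharp concise tensor

Sub-problem `MatrixMultiplication` (solo line `solo-MatrixMultiplication-informed`, gen 17).  The
catalyst door (`SoloInformedCatalystDoor.lean`) certifies `R̃(T_cw,2) = 3`, hence `ω = 2`, from ONE
identity `bR(T_cw,2^{⊠N} ⊕ s) ≤ 3^N + Q̃(s)`; `SoloInformedCatalystNoGo*.lean` closed it for unit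
and `1_A`-generic catalysts.  Here, for EVERY concise catalyst of cubic format `d × d × d` (the
format a certificate forces), over any field:
`lt_algBorderRank_kroneckerPow_cwTensor_two_directSum_of_finrank_le` — if `dim 𝔞(s) ≤ d` then
`3^N + d < bR(T_cw,2^{⊠N} ⊕ s)` for all `N ≥ 1`; contrapositively
(`lt_finrank_ker_lin111_of_cwTensor_two_catalyst`) a certificate forces `dim 𝔞(s) > d`: `s` is
111-abundant and NOT 111-sharp.  No such concise tensor is known (Jelisiejew–Landsberg–Pal 2023,
§1.4.1; it would need `d ≥ 6` and bounded rank `≤ d - 2` in all three directions, Cor. 5.5).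

Proof.  `𝔞 = ker lin111` (`MatMulDirectSumCubicFormat.lean`).  (1) 111-equations (Buczyńska–
Buczyński 2021 Thm. 1.2, in the tree: `lt_algBorderRank_of_finrank_ker_lin111_lt`): concise
`M × M × M` with `dim 𝔞 < M` has `bR > M`.  (2) `dim 𝔞(T ⊕ s) ≤ dim 𝔞(T) + dim 𝔞(s)`
(`SoloInformedOneOneOneDirectSum.lean`).  (3) For an `A`-concise `T` with invertible slice
`S = T(α)`, `(P,Q,R) ↦ Rᵀ` embeds `𝔞(T)` into the commutant of the normalised slice space
`S⁻¹T(A*)` intersected with that space (`commute_rBlockT`, `eq_zero_of_rBlockT_eq_zero`; JLP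
Prop. 3.2/3.3): hence `dim 𝔞(T) < |A|` if two normalised slices do not commute
(`finrank_ker_lin111_lt_card_of_ne`), and `dim 𝔞(T) ≤ 1` if the commutant is trivial
(`finrank_ker_lin111_le_one`).  (4) For `T = T_cw,2^{⊠N}` two one-site normalised slices do not
commute (`CatalystNoGo.cw_XY_entry/cw_YX_entry`), so `dim 𝔞(T_cw,2^{⊠N} ⊕ s) < 3^N + d`.

HONEST FRAMING: like the no-go files this REDUCES the catalyst door at every finite level to an
object not known to exist; it is a theorem about explicit tensors, not progress on `ω`.  0 sorries.

References: J. Jelisiejew, J. M. Landsberg, A. Pal, *Concise tensors of minimal border rank*,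
Math. Ann. 388 (2023), arXiv:2205.05713, §1.4.1, Lemma 3.1, Props. 3.2, 3.3, Cor. 5.5
[JelisiejewLandsbergPal2023]; W. Buczyńska, J. Buczyński, *Apolarity, border rank, and
multigraded Hilbert scheme*, Duke Math. J. 170 (2021), Thm. 1.2 [BuczynskaBuczynski2021].
-/

noncomputable section

open scoped BigOperators Matrix
open Matrix

namespace Summit.MatrixMultiplication.MatrixMultiplication.Theorems

open Literature.Computability.AlgebraicComplexity OneOneOneSplit CatalystNoGo

universe u

namespace CatalystAbundance

variable {K : Type u} [Field K]
variable {ι κ μ : Type*} [Fintype ι] [Fintype κ] [Fintype μ] [DecidableEq ι] [DecidableEq κ]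
  [DecidableEq μ]

/-! ## Contracting the 111-equations with a covector -/

/-- The `Q`-block of a flattened triple, as a matrix. [folklore] -/
def qBlock (c : TripleIndex ι κ μ → K) : Matrix κ κ K :=
  Matrix.of fun j j' => c (Sum.inr (Sum.inl (j, j')))

/-- The transposed `R`-block of a flattened triple, as a matrix. [folklore] -/
def rBlockT (c : TripleIndex ι κ μ → K) : Matrix μ μ K :=
  Matrix.of fun k k' => c (Sum.inr (Sum.inr (k', k)))

/-- The covector `α ∘ P` for the `P`-block of a flattened triple. [folklore] -/
def pVec (α : ι → K) (c : TripleIndex ι κ μ → K) : ι → K :=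
  fun i' => ∑ i, α i * c (Sum.inl (i, i'))

omit [Fintype κ] [Fintype μ] [DecidableEq ι] [DecidableEq κ] [DecidableEq μ] in
/-- `T(ζ)` of `P ·₁ T` is `T(ζ P)`. [folklore] -/
theorem contractFirst_contract₁ (ζ : ι → K) (P : ι → ι → K) (T : ι → κ → μ → K) :
    contractFirst ζ (contract₁ P T) = contractFirst (fun i' => ∑ i, ζ i * P i i') T := by
  ext j k
  simp only [contractFirst_apply, contract₁_apply, Finset.mul_sum, Finset.sum_mul]
  refine Finset.sum_comm.trans ?_
  exact Finset.sum_congr rfl fun _ _ => Finset.sum_congr rfl fun _ _ => by ring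

omit [Fintype μ] [DecidableEq ι] [DecidableEq κ] [DecidableEq μ] in
/-- `T(ζ)` of `Q ·₂ T` is `Q · T(ζ)`. [folklore] -/
theorem contractFirst_contract₂ (ζ : ι → K) (Q : κ → κ → K) (T : ι → κ → μ → K) :
    contractFirst ζ (contract₂ Q T) = Matrix.of (fun j j' => Q j j') * contractFirst ζ T := by
  ext j k
  simp only [contractFirst_apply, contract₂_apply, Matrix.mul_apply, Matrix.of_apply,
    Finset.mul_sum]
  refine Finset.sum_comm.trans ?_
  exact Finset.sum_congr rfl fun _ _ => Finset.sum_congr rfl fun _ _ => by ring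

omit [Fintype κ] [DecidableEq ι] [DecidableEq κ] [DecidableEq μ] in
/-- `T(ζ)` of `R ·₃ T` is `T(ζ) · Rᵀ`. [folklore] -/
theorem contractFirst_contract₃ (ζ : ι → K) (Rm : μ → μ → K) (T : ι → κ → μ → K) :
    contractFirst ζ (contract₃ Rm T) = contractFirst ζ T * Matrix.of (fun k k' => Rm k' k) := by
  ext j k
  simp only [contractFirst_apply, contract₃_apply, Matrix.mul_apply, Matrix.of_apply,
    Finset.mul_sum, Finset.sum_mul]
  refine Finset.sum_comm.trans ?_
  exact Finset.sum_congr rfl fun _ _ => Finset.sum_congr rfl fun _ _ => by ring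

omit [DecidableEq ι] [DecidableEq κ] [DecidableEq μ] in
/-- For `(P,Q,R) ∈ 𝔞(T)` and every covector `ζ`: `Q · T(ζ) = T(ζ) · Rᵀ`.
[cite: JelisiejewLandsbergPal2023, §3 (proof of Prop. 3.3)] -/
theorem qBlock_mul_contractFirst {T : ι → κ → μ → K} {c : TripleIndex ι κ μ → K}
    (h : lin111 T c = 0) (ζ : ι → K) :
    qBlock c * contractFirst ζ T = contractFirst ζ T * rBlockT c := by
  obtain ⟨-, hQR⟩ := (lin111_eq_zero_iff T c).1 h
  have e₂ := contractFirst_contract₂ ζ (fun x x' => c (Sum.inr (Sum.inl (x, x')))) T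
  have e₃ := contractFirst_contract₃ ζ (fun y y' => c (Sum.inr (Sum.inr (y, y')))) T
  rw [hQR] at e₂
  exact e₂.symm.trans e₃

omit [DecidableEq ι] [DecidableEq κ] [DecidableEq μ] in
/-- For `(P,Q,R) ∈ 𝔞(T)` and a covector `α`: `T(α P) = T(α) · Rᵀ`.
[cite: JelisiejewLandsbergPal2023, §3 (proof of Prop. 3.3)] -/
theorem contractFirst_pVec {T : ι → κ → μ → K} {c : TripleIndex ι κ μ → K}
    (h : lin111 T c = 0) (α : ι → K) :
    contractFirst (pVec α c) T = contractFirst α T * rBlockT c := by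
  obtain ⟨hPQ, hQR⟩ := (lin111_eq_zero_iff T c).1 h
  have e₁ := contractFirst_contract₁ α (fun z z' => c (Sum.inl (z, z'))) T
  have e₃ := contractFirst_contract₃ α (fun y y' => c (Sum.inr (Sum.inr (y, y')))) T
  rw [hPQ, hQR] at e₁
  exact e₁.symm.trans e₃

omit [Fintype κ] [Fintype μ] [DecidableEq ι] [DecidableEq κ] [DecidableEq μ] in
/-- `T(ζ)` is additive in the covector. [folklore] -/
theorem contractFirst_add_left (ζ ζ' : ι → K) (T : ι → κ → μ → K) :
    contractFirst (ζ + ζ') T = contractFirst ζ T + contractFirst ζ' T := by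
  ext b c
  simp [contractFirst_apply, add_mul, Finset.sum_add_distrib]

omit [Fintype κ] [Fintype μ] [DecidableEq ι] [DecidableEq κ] [DecidableEq μ] in
/-- `T(ζ)` is homogeneous in the covector. [folklore] -/
theorem contractFirst_smul_left (a : K) (ζ : ι → K) (T : ι → κ → μ → K) :
    contractFirst (a • ζ) T = a • contractFirst ζ T := by
  ext b c
  simp [contractFirst_apply, Finset.mul_sum, mul_assoc]

/-! ## `Rᵀ` lies in the commutant of the normalised slices; `(P,Q,R) ↦ Rᵀ` is injective -/

omit [DecidableEq ι] in
/-- For `(P,Q,R) ∈ 𝔞(T)` and an invertible slice `S = T(α)`: `Q = S Rᵀ S⁻¹`.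
[cite: JelisiejewLandsbergPal2023, Prop. 3.2 (proof)] -/
theorem qBlock_eq {T : ι → κ → κ → K} {c : TripleIndex ι κ κ → K} (h : lin111 T c = 0)
    (α : ι → K) (hα : IsUnit (contractFirst α T)) :
    qBlock c = contractFirst α T * rBlockT c * (contractFirst α T)⁻¹ := by
  rw [← qBlock_mul_contractFirst h α, Matrix.mul_assoc,
    Matrix.mul_nonsing_inv _ ((Matrix.isUnit_iff_isUnit_det _).1 hα), Matrix.mul_one]

omit [DecidableEq ι] in
/-- For `(P,Q,R) ∈ 𝔞(T)` and an invertible slice `S = T(α)`: `Rᵀ` commutes with every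
normalised slice `S⁻¹ T(ζ)`. [cite: JelisiejewLandsbergPal2023, Prop. 3.2 (proof)] -/
theorem commute_rBlockT {T : ι → κ → κ → K} {c : TripleIndex ι κ κ → K} (h : lin111 T c = 0)
    (α : ι → K) (hα : IsUnit (contractFirst α T)) (ζ : ι → K) :
    Commute ((contractFirst α T)⁻¹ * contractFirst ζ T) (rBlockT c) := by
  have hdet := (Matrix.isUnit_iff_isUnit_det _).1 hα
  show (contractFirst α T)⁻¹ * contractFirst ζ T * rBlockT c =
    rBlockT c * ((contractFirst α T)⁻¹ * contractFirst ζ T)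
  calc (contractFirst α T)⁻¹ * contractFirst ζ T * rBlockT c
      = (contractFirst α T)⁻¹ * (qBlock c * contractFirst ζ T) := by
        rw [Matrix.mul_assoc, qBlock_mul_contractFirst h]
    _ = (contractFirst α T)⁻¹ * contractFirst α T * rBlockT c *
          ((contractFirst α T)⁻¹ * contractFirst ζ T) := by
        rw [qBlock_eq h α hα]; simp only [Matrix.mul_assoc]
    _ = rBlockT c * ((contractFirst α T)⁻¹ * contractFirst ζ T) := by
        rw [Matrix.nonsing_inv_mul _ hdet, Matrix.one_mul]

omit [DecidableEq ι] in
/-- For an `A`-concise `T` with an invertible slice, `(P,Q,R) ↦ Rᵀ` is injective on `𝔞(T)`.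
[cite: JelisiejewLandsbergPal2023, Lemma 3.1] -/
theorem eq_zero_of_rBlockT_eq_zero {T : ι → κ → κ → K} (hA : LinearIndependent K fun i => T i)
    (α : ι → K) (hα : IsUnit (contractFirst α T)) {c : TripleIndex ι κ κ → K}
    (h : lin111 T c = 0) (h0 : rBlockT c = 0) : c = 0 := by
  obtain ⟨hPQ, -⟩ := (lin111_eq_zero_iff T c).1 h
  have hR : ∀ k k', c (Sum.inr (Sum.inr (k, k'))) = 0 := fun k k' => by
    have := congr_fun (congr_fun h0 k') k
    simpa [rBlockT] using this
  have hQ0 : qBlock c = 0 := by rw [qBlock_eq h α hα, h0, Matrix.mul_zero, Matrix.zero_mul]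
  have hQ : ∀ j j', c (Sum.inr (Sum.inl (j, j'))) = 0 := fun j j' => by
    have := congr_fun (congr_fun hQ0 j) j'
    simpa [qBlock] using this
  have hc1 : contract₁ (fun z z' => c (Sum.inl (z, z'))) T = 0 := by
    rw [hPQ]
    funext i j k
    simp [contract₂_apply, hQ]
  have hP : ∀ i i', c (Sum.inl (i, i')) = 0 := by
    intro i
    refine Fintype.linearIndependent_iff.1 hA (fun i' => c (Sum.inl (i, i'))) ?_
    funext j k
    have := congr_fun (congr_fun (congr_fun hc1 i) j) k
    simpa [contract₁_apply, Finset.sum_apply] using this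
  funext t
  rcases t with ⟨i, i'⟩ | ⟨j, j'⟩ | ⟨k, k'⟩
  exacts [hP i i', hQ j j', hR k k']

/-- The linear map `(P,Q,R) ↦ Rᵀ` on flattened triples. [folklore] -/
def rBlockTLin : (TripleIndex ι κ μ → K) →ₗ[K] Matrix μ μ K where
  toFun := rBlockT
  map_add' _ _ := rfl
  map_smul' _ _ := rfl

omit [Fintype μ] [DecidableEq ι] [DecidableEq μ] in
/-- **Trivial commutant ⟹ `dim 𝔞(T) ≤ 1`.**  If `T` is `A`-concise with an invertible slice
`S = T(α)` and every matrix commuting with all normalised slices `S⁻¹T(ζ)` is scalar, then the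
111-algebra of `T` is at most one-dimensional (it is then exactly `K·(1,1,1)`).
[cite: JelisiejewLandsbergPal2023, Prop. 3.2] -/
theorem finrank_ker_lin111_le_one (T : ι → κ → κ → K) (hA : LinearIndependent K fun i => T i)
    (α : ι → K) (hα : IsUnit (contractFirst α T))
    (hscalar : ∀ W : Matrix κ κ K,
      (∀ ζ, Commute ((contractFirst α T)⁻¹ * contractFirst ζ T) W) →
        W ∈ Set.range (Matrix.scalar κ)) :
    Module.finrank K (LinearMap.ker (lin111 T)) ≤ 1 := by
  let θ := (rBlockTLin (ι := ι) (κ := κ) (μ := κ) (K := K)).comp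
    (LinearMap.ker (lin111 T)).subtype
  have hθinj : Function.Injective θ := (injective_iff_map_eq_zero θ).2 fun c hc =>
    Subtype.ext (eq_zero_of_rBlockT_eq_zero hA α hα c.2 hc)
  have hle : LinearMap.range θ ≤ K ∙ (1 : Matrix κ κ K) := by
    rintro _ ⟨c, rfl⟩
    obtain ⟨a, ha⟩ := hscalar _ fun ζ => commute_rBlockT c.2 α hα ζ
    refine Submodule.mem_span_singleton.2 ⟨a, ?_⟩
    show a • (1 : Matrix κ κ K) = rBlockT c.1
    rw [← ha, Matrix.scalar_apply, Matrix.smul_one_eq_diagonal]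
  calc Module.finrank K (LinearMap.ker (lin111 T))
      = Module.finrank K (LinearMap.range θ) := (LinearMap.finrank_range_of_inj hθinj).symm
    _ ≤ Module.finrank K ↥(K ∙ (1 : Matrix κ κ K)) := Submodule.finrank_mono hle
    _ ≤ 1 := (finrank_span_le_card ({1} : Set (Matrix κ κ K))).trans (by simp)

/-! ## `1_A`-generic tensors with non-commuting normalised slices are not 111-abundant -/

omit [Fintype μ] [DecidableEq ι] [DecidableEq μ] in
/-- **JLP 2023, Prop. 3.3 (necessity of "abelian"), dimension form.**  Let `T ∈ K^ι ⊗ K^κ ⊗ K^κ`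
be `A`-concise with an invertible slice `S = T(α)`.  If two normalised slices `S⁻¹T(ξ)`,
`S⁻¹T(η)` do not commute, then `dim 𝔞(T) < |ι|`: `T` is not 111-abundant.
[cite: JelisiejewLandsbergPal2023, Prop. 3.3, §3] -/
theorem finrank_ker_lin111_lt_card_of_ne (T : ι → κ → κ → K)
    (hA : LinearIndependent K fun i => T i) (α : ι → K) (hα : IsUnit (contractFirst α T))
    (ξ η : ι → K)
    (hne : (contractFirst α T)⁻¹ * contractFirst ξ T * ((contractFirst α T)⁻¹ * contractFirst η T)
      ≠ (contractFirst α T)⁻¹ * contractFirst η T * ((contractFirst α T)⁻¹ * contractFirst ξ T)) :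
    Module.finrank K (LinearMap.ker (lin111 T)) < Fintype.card ι := by
  set S := contractFirst α T with hS
  have hdet : IsUnit S.det := (Matrix.isUnit_iff_isUnit_det _).1 hα
  have hSiS : S⁻¹ * S = 1 := Matrix.nonsing_inv_mul _ hdet
  -- the restriction of `(P,Q,R) ↦ Rᵀ` to the 111-space
  let θ := (rBlockTLin (ι := ι) (κ := κ) (μ := κ) (K := K)).comp
    (LinearMap.ker (lin111 T)).subtype
  -- the normalised slice map `ζ ↦ S⁻¹ T(ζ)` and the commutator with `Y = S⁻¹ T(η)`
  let ε : (ι → K) →ₗ[K] Matrix κ κ K :=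
    { toFun := fun ζ => S⁻¹ * contractFirst ζ T
      map_add' := fun ζ ζ' => by simp only [contractFirst_add_left, Matrix.mul_add]
      map_smul' := fun a ζ => by
        simp only [contractFirst_smul_left, Matrix.mul_smul, RingHom.id_apply] }
  let Y : Matrix κ κ K := S⁻¹ * contractFirst η T
  let γ : Matrix κ κ K →ₗ[K] Matrix κ κ K := LinearMap.mulRight K Y - LinearMap.mulLeft K Y
  have hγ : ∀ W, γ W = W * Y - Y * W := fun W => by
    simp only [γ, LinearMap.sub_apply, LinearMap.mulRight_apply, LinearMap.mulLeft_apply]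
  -- what the 111-equations say about `W = Rᵀ`
  have key : ∀ c : LinearMap.ker (lin111 T),
      θ c ∈ LinearMap.range ε ∧ γ (θ c) = 0 ∧ (θ c = 0 → c = 0) := by
    intro c
    have hθ : θ c = rBlockT c.1 := rfl
    refine ⟨⟨pVec α c.1, ?_⟩, ?_, fun h0 => Subtype.ext (eq_zero_of_rBlockT_eq_zero hA α hα c.2 h0)⟩
    · show S⁻¹ * contractFirst (pVec α c.1) T = θ c
      rw [contractFirst_pVec c.2, ← hS, ← Matrix.mul_assoc, hSiS, Matrix.one_mul, hθ]
    · rw [hγ, hθ, sub_eq_zero]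
      exact ((commute_rBlockT c.2 α hα η).eq).symm
  -- dimension count
  have hθinj : Function.Injective θ :=
    (injective_iff_map_eq_zero θ).2 fun c hc => (key c).2.2 hc
  have hrange : LinearMap.range θ ≤ LinearMap.range ε ⊓ LinearMap.ker γ := by
    rintro _ ⟨c, rfl⟩
    exact ⟨(key c).1, (key c).2.1⟩
  have hX : ε ξ ∈ LinearMap.range ε := ⟨ξ, rfl⟩
  have hXC : ε ξ ∉ LinearMap.range ε ⊓ LinearMap.ker γ := by
    rintro ⟨-, hXγ⟩
    apply hne
    have h0 : ε ξ * Y - Y * ε ξ = 0 := by rw [← hγ]; exact hXγ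
    exact sub_eq_zero.1 h0
  have hlt : LinearMap.range ε ⊓ LinearMap.ker γ < LinearMap.range ε :=
    lt_of_le_of_ne inf_le_left fun h => hXC (by rw [h]; exact hX)
  calc Module.finrank K (LinearMap.ker (lin111 T))
      = Module.finrank K (LinearMap.range θ) := (LinearMap.finrank_range_of_inj hθinj).symm
    _ ≤ Module.finrank K ↥(LinearMap.range ε ⊓ LinearMap.ker γ) := Submodule.finrank_mono hrange
    _ < Module.finrank K (LinearMap.range ε) := Submodule.finrank_lt_finrank_of_lt hlt
    _ ≤ Module.finrank K (ι → K) := LinearMap.finrank_range_le ε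
    _ = Fintype.card ι := Module.finrank_fintype_fun_eq_card K

end CatalystAbundance

/-! ## The Coppersmith–Winograd powers -/

section CW

open CatalystAbundance

variable (K : Type u) [Field K]

/-- `S^{⊗N} = T_cw,2^{⊠N}((a₀^*+a₁^*)^{⊗N})` is invertible. [folklore] -/
theorem isUnit_contractFirst_prodCovector_cwα (N : ℕ) : IsUnit
    (contractFirst (prodCovector fun _ : Fin N => cwα K) (kroneckerPow (cwTensor K 2) N)) := by
  rw [contractFirst_prodCovector_kroneckerPow, ← powMatrix_eq_piMatrix]
  exact isUnit_powMatrix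
    ((Matrix.isUnit_iff_isUnit_det _).2 (Matrix.isUnit_det_of_left_inverse (cwSinv_mul_S K))) N

/-- `T_cw,2^{⊠N}` is concise (`1_A`-generic and cyclically symmetric). [folklore] -/
theorem isConcise3_kroneckerPow_cwTensor_two (N : ℕ) :
    IsConcise3 (kroneckerPow (cwTensor K 2) N) := by
  have hα := isUnit_contractFirst_prodCovector_cwα K N
  have hrot : rotate (kroneckerPow (cwTensor K 2) N) = kroneckerPow (cwTensor K 2) N := by
    rw [rotate_kroneckerPow, rotate_cwTensor]
  refine ⟨?_, linearIndependent_rotate_of_isUnit_contractFirst _ _ hα,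
    linearIndependent_rotate_rotate_of_isUnit_contractFirst _ _ hα⟩
  have h := linearIndependent_rotate_rotate_of_isUnit_contractFirst
    (rotate (kroneckerPow (cwTensor K 2) N)) (prodCovector fun _ : Fin N => cwα K)
    (by rw [hrot]; exact hα)
  simpa only [hrot] using h

/-- **`T_cw,2^{⊠N}` is not 111-abundant** (`N ≥ 1`): `dim 𝔞(T_cw,2^{⊠N}) < 3^N`, over any field —
the normalised slices `S⁻¹T_cw,2(a₁^*) ⊗ 1 ⊗ ⋯`, `S⁻¹T_cw,2(a₂^*) ⊗ 1 ⊗ ⋯` do not commute.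
[cite: JelisiejewLandsbergPal2023, Prop. 3.3] -/
theorem finrank_ker_lin111_kroneckerPow_cwTensor_two_lt (N : ℕ) :
    Module.finrank K (LinearMap.ker (lin111 (kroneckerPow (cwTensor K 2) (N + 1)))) <
      3 ^ (N + 1) := by
  have hα := isUnit_contractFirst_prodCovector_cwα K (N + 1)
  have hGS : powMatrix (cwSinv K) (N + 1) *
      contractFirst (prodCovector fun _ : Fin (N + 1) => cwα K)
        (kroneckerPow (cwTensor K 2) (N + 1)) = 1 := by
    rw [contractFirst_prodCovector_kroneckerPow, powMatrix_eq_piMatrix, piMatrix_mul,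
      cwSinv_mul_S, piMatrix_one]
  have hinv := Matrix.inv_eq_left_inv hGS
  have hcard : Fintype.card (Fin (N + 1) → Fin 3) = 3 ^ (N + 1) := by simp
  rw [← hcard]
  refine finrank_ker_lin111_lt_card_of_ne _ (isConcise3_kroneckerPow_cwTensor_two K (N + 1)).1 _
    hα (prodCovector (Fin.cons (cwβ K) fun _ : Fin N => cwα K))
    (prodCovector (Fin.cons (cwγ K) fun _ : Fin N => cwα K)) ?_
  have hX : ∀ δ : Fin 3 → K,
      (contractFirst (prodCovector fun _ : Fin (N + 1) => cwα K)
          (kroneckerPow (cwTensor K 2) (N + 1)))⁻¹ *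
        contractFirst (prodCovector (Fin.cons δ fun _ : Fin N => cwα K))
          (kroneckerPow (cwTensor K 2) (N + 1)) =
      piMatrix fun i => cwSinv K *
        contractFirst ((Fin.cons δ (fun _ : Fin N => cwα K) : Fin (N + 1) → Fin 3 → K) i)
          (cwTensor K 2) := by
    intro δ
    rw [hinv, contractFirst_prodCovector_kroneckerPow, powMatrix_eq_piMatrix, piMatrix_mul]
  rw [hX, hX]
  simp only [piMatrix_mul]
  intro hP
  have hentry := congr_fun (congr_fun hP (Fin.cons 1 fun _ => 0)) (Fin.cons 2 fun _ => 0)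
  simp only [piMatrix_apply, Fin.prod_univ_succ, Fin.cons_zero, Fin.cons_succ, cwSinv_mul_S,
    Matrix.one_apply_eq, Finset.prod_const_one, mul_one] at hentry
  rw [cw_XY_entry, cw_YX_entry] at hentry
  exact zero_ne_one hentry

/-! ## The catalyst door needs a 111-abundant, non-111-sharp concise tensor -/

variable {ι' κ' μ' : Type*} [Fintype ι'] [Fintype κ'] [Fintype μ'] [DecidableEq ι']
  [DecidableEq κ'] [DecidableEq μ']

/-- **Sharp catalysts cannot certify the catalyst door at any finite level.**  If
`s ∈ K^d ⊗ K^d ⊗ K^d` is concise with `dim 𝔞(s) ≤ d`, then `3^N + d < bR(T_cw,2^{⊠N} ⊕ s)` for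
every `N ≥ 1`, over any field.
[cite: BuczynskaBuczynski2021, Thm. 1.2] [cite: JelisiejewLandsbergPal2023, §1.1, Prop. 3.3] -/
theorem lt_algBorderRank_kroneckerPow_cwTensor_two_directSum_of_finrank_le
    (s : ι' → κ' → μ' → K) (hs : IsConcise3 s) {d : ℕ} (hι : Fintype.card ι' = d)
    (hκ : Fintype.card κ' = d) (hμ : Fintype.card μ' = d)
    (hsharp : Module.finrank K (LinearMap.ker (lin111 s)) ≤ d) (N : ℕ) :
    3 ^ (N + 1) + d <
      algBorderRank (directSumTensor (kroneckerPow (cwTensor K 2) (N + 1)) s) := by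
  have hTc := isConcise3_kroneckerPow_cwTensor_two K (N + 1)
  have hDc := isConcise3_directSumTensor hTc hs
  refine lt_algBorderRank_of_finrank_ker_lin111_lt K _ hDc.1 hDc.2.1 hDc.2.2
    (by simp [Fintype.card_sum, hι]) (by simp [Fintype.card_sum, hκ])
    (by simp [Fintype.card_sum, hμ]) ?_
  have h1 := finrank_ker_lin111_directSum_le hTc hs
  have h2 := finrank_ker_lin111_kroneckerPow_cwTensor_two_lt K N
  omega

/-- **The catalyst door, at any finite level, requires JLP's unknown object.**  A certificate
`bR(T_cw,2^{⊠N} ⊕ s) ≤ 3^N + d`, `N ≥ 1`, with a concise `d × d × d` catalyst forces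
`dim 𝔞(s) > d`: `s` is 111-abundant and not 111-sharp — no example is known (JLP 2023, §1.4.1;
none with `d ≤ 5`). [cite: JelisiejewLandsbergPal2023, §1.4.1, Thm. 1.5]
[cite: BuczynskaBuczynski2021, Thm. 1.2] -/
theorem lt_finrank_ker_lin111_of_cwTensor_two_catalyst
    (s : ι' → κ' → μ' → K) (hs : IsConcise3 s) {d : ℕ} (hι : Fintype.card ι' = d)
    (hκ : Fintype.card κ' = d) (hμ : Fintype.card μ' = d) {N : ℕ} (hN : N ≠ 0)
    (hcert : algBorderRank (directSumTensor (kroneckerPow (cwTensor K 2) N) s) ≤ 3 ^ N + d) :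
    d < Module.finrank K (LinearMap.ker (lin111 s)) := by
  obtain ⟨n, rfl⟩ := Nat.exists_eq_succ_of_ne_zero hN
  by_contra h
  exact absurd hcert (not_le.2
    (lt_algBorderRank_kroneckerPow_cwTensor_two_directSum_of_finrank_le K s hs hι hκ hμ
      (not_lt.1 h) n))

end CW

end Summit.MatrixMultiplication.MatrixMultiplication.Theorems

end
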